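import Mathlib.NumberTheory.LocalField.Basic
import Mathlib.RingTheory.Henselian
import Mathlib.RingTheory.Filtration
import Mathlib.FieldTheory.Finite.Basic
import Mathlib.GroupTheory.OrderOfElement
import Mathlib.Data.Nat.Prime.Infinite

/-!
# Units of a mixed-characteristic local field are the infinitely `ℓ`-divisible elements
# ([AbsTopIII] Remark 3.1.1)

Kernel proof (theorems only, Mathlib-only, no new definitions) of the claim recorded in
S. Mochizuki, *Topics in absolute anabelian geometry III*, Remark 3.1.1 (kurims manuscript p.70, lit
key `paper:url-5493eb38cbb7`; bib key `MochizukiAbsTopIII2015`): for an MLF `k` (and hence for every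
finite extension of `k`, i.e. for the invariants of `k̄^×` under any open subgroup of `G_k`),
"`𝒪_k^× ⊆ k^×` may be characterized as the subgroup of elements divisible by arbitrary powers of some
prime number" — so that the submonoids `𝒪^× ⊆ 𝒪^⊳ ⊆ k^×` (and with them the topology, Rmk 3.1.1) are
determined by the bare group structure of `k^×`.

Precisely, for a nonarchimedean local field `K` (Mathlib `IsNonarchimedeanLocalField`) and `x ≠ 0`:
`v(x) = 1 ↔ ∃ ℓ prime, ∀ n, ∃ y : K, y ^ ℓ ^ n = x`
(`valuation_eq_one_iff_exists_prime_forall_exists_pow_eq`).  `⇐`: the valuation ring is a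
Noetherian local domain, so a non-unit with `ℓⁿ`-th roots for all `n` lies in `⋂ₙ 𝓂^{ℓⁿ} = 0`
(Krull).  `⇒`: for a prime `ℓ` exceeding the cardinality `q` of the residue field, `ℓ` is a unit of
`𝒪_K` and `z ↦ z^ℓ` is a bijection of `𝓀^×` (`gcd(ℓ, q − 1) = 1`), so `Y^ℓ − u` has a simple root
modulo `𝓂` for every unit `u`, which lifts by Hensel's lemma (`𝒪_K` is `𝓂`-adically complete:
Mathlib `IsAdicComplete.henselianRing`); iterate.

NOTE (typing of Rmk 3.1.1): the characterisation is FALSE verbatim inside an algebraic closure `k̄`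
(every nonzero element of an algebraically closed field has `ℓⁿ`-th roots for all `ℓ, n`); the text
applies it "to the various subfields, subgroups, or submonoids obtained … by taking the invariants with
respect to some open subgroup of the Galois group", i.e. at the finite levels, each of which is again
an MLF — the form proved here.
HONEST FRAMING: OUR kernel check of a classical fact quoted by a refereed paper; it takes no side on
[IUTchIII] Cor 3.12.
-/

namespace Literature.AnabelianGeometry.AbsoluteAnabelian

open _root_.ValuativeRel _root_.Polynomial

variable (K : Type*) [Field K] [ValuativeRel K] [TopologicalSpace K] [IsNonarchimedeanLocalField K]

/-- The valuation ring of a nonarchimedean local field is Henselian at its maximal ideal (it is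
`𝓂`-adically complete).
[cite: MochizukiAbsTopIII2015, Remark 3.1.1 p.70] -/
theorem IsNonarchimedeanLocalField.henselianRing_integer : HenselianRing 𝒪[K] 𝓂[K] := by
  letI := IsTopologicalAddGroup.rightUniformSpace K
  haveI := isUniformAddGroup_of_addCommGroup (G := K)
  infer_instance

/-- For a nonarchimedean local field `K` there is a prime `ℓ` (any prime exceeding the cardinality
of the residue field) such that every unit of `𝒪_K` is an `ℓ`-th power of a unit.
[cite: MochizukiAbsTopIII2015, Remark 3.1.1 p.70] -/
theorem IsNonarchimedeanLocalField.exists_prime_forall_isUnit_exists_pow_eq :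
    ∃ ℓ : ℕ, ℓ.Prime ∧ ∀ u : 𝒪[K], IsUnit u → ∃ y : 𝒪[K], IsUnit y ∧ y ^ ℓ = u := by
  classical
  haveI : Fintype 𝓀[K] := Fintype.ofFinite _
  haveI : HenselianRing 𝒪[K] 𝓂[K] := IsNonarchimedeanLocalField.henselianRing_integer K
  obtain ⟨ℓ, hqℓ, hℓ⟩ := Nat.exists_infinite_primes (Fintype.card 𝓀[K] + 1)
  refine ⟨ℓ, hℓ, fun u hu => ?_⟩
  have hℓ0 : ℓ ≠ 0 := hℓ.ne_zero
  -- `ℓ` is invertible in the residue field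
  have hℓk : (ℓ : 𝓀[K]) ≠ 0 := by
    intro h
    have h1 : ringChar 𝓀[K] = ℓ := CharP.ringChar_of_prime_eq_zero hℓ h
    have h2 : ringChar 𝓀[K] ∣ Fintype.card 𝓀[K] :=
      ringChar.dvd (FiniteField.cast_card_eq_zero 𝓀[K])
    rw [h1] at h2
    have := Nat.le_of_dvd Fintype.card_pos h2
    omega
  -- `z ↦ z ^ ℓ` is a bijection of the (finite) unit group of the residue field
  have hcop : (Nat.card 𝓀[K]ˣ).Coprime ℓ := by
    have hle : Nat.card 𝓀[K]ˣ ≤ Fintype.card 𝓀[K] := by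
      rw [← Nat.card_eq_fintype_card]
      exact Nat.card_le_card_of_injective (fun z : 𝓀[K]ˣ => (z : 𝓀[K])) Units.val_injective
    have hpos : Nat.card 𝓀[K]ˣ ≠ 0 := Nat.card_pos.ne'
    exact (Nat.coprime_of_lt_prime hpos (by omega) hℓ).symm
  have hu' : IsUnit (IsLocalRing.residue 𝒪[K] u) := hu.map _
  obtain ⟨zbar, hz⟩ := (powCoprime hcop).surjective hu'.unit
  rw [powCoprime_apply] at hz
  obtain ⟨a₀, ha₀⟩ := IsLocalRing.residue_surjective (R := 𝒪[K]) (zbar : 𝓀[K])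
  -- Hensel's lemma for `Y ^ ℓ - u` at `a₀`
  have hmonic : (X ^ ℓ - C u : 𝒪[K][X]).Monic := monic_X_pow_sub_C u hℓ0
  have h₁ : (X ^ ℓ - C u : 𝒪[K][X]).eval a₀ ∈ 𝓂[K] := by
    rw [← IsLocalRing.residue_eq_zero_iff]
    simp only [eval_sub, eval_pow, eval_X, eval_C, map_sub, map_pow, ha₀]
    rw [← Units.val_pow_eq_pow_val, hz, IsUnit.unit_spec, sub_self]
  have h₂ : IsUnit (Ideal.Quotient.mk 𝓂[K] ((X ^ ℓ - C u : 𝒪[K][X]).derivative.eval a₀)) := by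
    change IsUnit (IsLocalRing.residue 𝒪[K] ((X ^ ℓ - C u : 𝒪[K][X]).derivative.eval a₀))
    rw [isUnit_iff_ne_zero]
    simp only [derivative_sub, derivative_X_pow, derivative_C, sub_zero, eval_mul, eval_natCast,
      eval_pow, eval_X, map_mul, map_natCast, map_pow, ha₀]
    exact mul_ne_zero hℓk (pow_ne_zero _ zbar.ne_zero)
  obtain ⟨a, hroot, -⟩ := HenselianRing.is_henselian (X ^ ℓ - C u) hmonic a₀ h₁ h₂
  have ha : a ^ ℓ = u := by
    have : (X ^ ℓ - C u : 𝒪[K][X]).eval a = 0 := hroot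
    simpa [sub_eq_zero] using this
  exact ⟨a, (isUnit_pow_iff hℓ0).mp (ha ▸ hu), ha⟩

/-- Iterating: every unit of `𝒪_K` has `ℓⁿ`-th roots (which are units) for all `n`, for a suitable
prime `ℓ`.
[cite: MochizukiAbsTopIII2015, Remark 3.1.1 p.70] -/
theorem IsNonarchimedeanLocalField.exists_prime_forall_isUnit_exists_pow_pow_eq :
    ∃ ℓ : ℕ, ℓ.Prime ∧ ∀ (n : ℕ) (u : 𝒪[K]), IsUnit u → ∃ y : 𝒪[K], IsUnit y ∧ y ^ ℓ ^ n = u := by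
  obtain ⟨ℓ, hℓ, h⟩ := IsNonarchimedeanLocalField.exists_prime_forall_isUnit_exists_pow_eq K
  refine ⟨ℓ, hℓ, fun n => ?_⟩
  induction n with
  | zero => exact fun u hu => ⟨u, hu, by simp⟩
  | succ n ih =>
    intro u hu
    obtain ⟨y, hy, hyu⟩ := ih u hu
    obtain ⟨z, hz, hzy⟩ := h y hy
    exact ⟨z, hz, by rw [pow_succ', pow_mul, hzy, hyu]⟩

/-- The `⇐` half at the integral level: a nonzero `x` with `v(x) ≤ 1` admitting `ℓⁿ`-th roots in
`K` for all `n` (some prime `ℓ`) is a unit, by the Krull intersection theorem in the Noetherian local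
ring `𝒪_K`.
[cite: MochizukiAbsTopIII2015, Remark 3.1.1 p.70] -/
theorem IsNonarchimedeanLocalField.valuation_eq_one_of_forall_exists_pow_eq {x : K} (hx : x ≠ 0)
    (hx1 : valuation K x ≤ 1) {ℓ : ℕ} (hℓ : ℓ.Prime) (h : ∀ n : ℕ, ∃ y : K, y ^ ℓ ^ n = x) :
    valuation K x = 1 := by
  by_contra hne
  have hlt : valuation K x < 1 := lt_of_le_of_ne hx1 hne
  set xo : 𝒪[K] := ⟨x, (Valuation.mem_integer_iff _ _).mpr hx1⟩ with hxo
  have hxm : xo ∈ 𝓂[K] := by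
    rw [IsLocalRing.mem_maximalIdeal, mem_nonunits_iff,
      Valuation.Integer.not_isUnit_iff_valuation_lt_one]
    exact hlt
  have hmem : ∀ k : ℕ, xo ∈ 𝓂[K] ^ k := by
    intro k
    obtain ⟨y, hy⟩ := h k
    have hk : k < ℓ ^ k := Nat.lt_pow_self hℓ.one_lt
    have hy1 : valuation K y ≤ 1 := by
      have : valuation K y ^ ℓ ^ k ≤ 1 := by rw [← map_pow, hy]; exact hx1
      exact (pow_le_one_iff (pow_ne_zero _ hℓ.ne_zero)).mp this
    set yo : 𝒪[K] := ⟨y, (Valuation.mem_integer_iff _ _).mpr hy1⟩ with hyo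
    have hyx : yo ^ ℓ ^ k = xo := Subtype.ext (by simp [hyo, hxo, hy])
    have hym : yo ∈ 𝓂[K] :=
      (Ideal.IsMaximal.isPrime inferInstance).mem_of_pow_mem (ℓ ^ k) (hyx ▸ hxm)
    have hxk : xo ∈ 𝓂[K] ^ ℓ ^ k := hyx ▸ Ideal.pow_mem_pow hym _
    exact Ideal.pow_le_pow_right hk.le hxk
  have hbot : (⨅ k : ℕ, 𝓂[K] ^ k) = ⊥ :=
    Ideal.iInf_pow_eq_bot_of_isLocalRing _ (Ideal.IsMaximal.ne_top inferInstance)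
  have hx0 : xo ∈ (⨅ k : ℕ, 𝓂[K] ^ k) := by
    rw [Ideal.mem_iInf]
    exact hmem
  rw [hbot, Ideal.mem_bot] at hx0
  exact hx (congrArg Subtype.val hx0)

/-- **[AbsTopIII] Rmk 3.1.1** (for an MLF; Mathlib: any nonarchimedean local field): a nonzero
element is a unit of the ring of integers iff it is divisible by arbitrary powers of some prime number
— "`𝒪_k^× ⊆ k^×` may be characterized as the subgroup of elements divisible by arbitrary powers of
some prime number".
[cite: MochizukiAbsTopIII2015, Remark 3.1.1 p.70] -/
theorem IsNonarchimedeanLocalField.valuation_eq_one_iff_exists_prime_forall_exists_pow_eq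
    {x : K} (hx : x ≠ 0) :
    valuation K x = 1 ↔ ∃ ℓ : ℕ, ℓ.Prime ∧ ∀ n : ℕ, ∃ y : K, y ^ ℓ ^ n = x := by
  constructor
  · intro hvx
    obtain ⟨ℓ, hℓ, h⟩ := IsNonarchimedeanLocalField.exists_prime_forall_isUnit_exists_pow_pow_eq K
    refine ⟨ℓ, hℓ, fun n => ?_⟩
    have hxO : x ∈ 𝒪[K] := by
      rw [Valuation.mem_integer_iff, hvx]
    have hu : IsUnit (⟨x, hxO⟩ : 𝒪[K]) :=
      (Valuation.integer.integers (valuation K)).isUnit_iff_valuation_eq_one.mpr hvx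
    obtain ⟨y, -, hy⟩ := h n ⟨x, hxO⟩ hu
    exact ⟨y, by simpa using congrArg Subtype.val hy⟩
  · rintro ⟨ℓ, hℓ, h⟩
    rcases le_total (valuation K x) 1 with hle | hge
    · exact IsNonarchimedeanLocalField.valuation_eq_one_of_forall_exists_pow_eq K hx hle hℓ h
    · have hx' : x⁻¹ ≠ 0 := inv_ne_zero hx
      have hpos : 0 < valuation K x := (Valuation.pos_iff _).mpr hx
      have hle' : valuation K x⁻¹ ≤ 1 := by
        rw [map_inv₀]
        exact (inv_le_one₀ hpos).mpr hge
      have h' : ∀ n, ∃ y : K, y ^ ℓ ^ n = x⁻¹ := fun n => by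
        obtain ⟨y, hy⟩ := h n
        exact ⟨y⁻¹, by rw [inv_pow, hy]⟩
      have := IsNonarchimedeanLocalField.valuation_eq_one_of_forall_exists_pow_eq K hx' hle' hℓ h'
      rwa [map_inv₀, inv_eq_one] at this

/-- **[AbsTopIII] Rmk 3.1.1**, unit form: an element of `𝒪_K` that is nonzero in `K` is a unit of
`𝒪_K` iff it has `ℓⁿ`-th roots in `K` for all `n`, for some prime `ℓ`.
[cite: MochizukiAbsTopIII2015, Remark 3.1.1 p.70] -/
theorem IsNonarchimedeanLocalField.isUnit_integer_iff_exists_prime_forall_exists_pow_eq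
    (x : 𝒪[K]) (hx : (x : K) ≠ 0) :
    IsUnit x ↔ ∃ ℓ : ℕ, ℓ.Prime ∧ ∀ n : ℕ, ∃ y : K, y ^ ℓ ^ n = x := by
  rw [(Valuation.integer.integers (valuation K)).isUnit_iff_valuation_eq_one]
  exact IsNonarchimedeanLocalField.valuation_eq_one_iff_exists_prime_forall_exists_pow_eq K hx

/-- **[AbsTopIII] Rmk 3.1.1**, membership form: a nonzero `x ∈ K` lies in `𝒪_K` together with its
inverse iff it has `ℓⁿ`-th roots in `K` for all `n`, for some prime `ℓ`.
[cite: MochizukiAbsTopIII2015, Remark 3.1.1 p.70] -/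
theorem IsNonarchimedeanLocalField.mem_integer_and_inv_mem_iff_exists_prime_forall_exists_pow_eq
    {x : K} (hx : x ≠ 0) :
    (x ∈ 𝒪[K] ∧ x⁻¹ ∈ 𝒪[K]) ↔ ∃ ℓ : ℕ, ℓ.Prime ∧ ∀ n : ℕ, ∃ y : K, y ^ ℓ ^ n = x := by
  rw [← IsNonarchimedeanLocalField.valuation_eq_one_iff_exists_prime_forall_exists_pow_eq K hx,
    Valuation.mem_integer_iff, Valuation.mem_integer_iff, map_inv₀]
  have hpos : 0 < valuation K x := (Valuation.pos_iff _).mpr hx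
  constructor
  · rintro ⟨h1, h2⟩
    exact le_antisymm h1 ((inv_le_one₀ hpos).mp h2)
  · intro h
    simp [h]

end Literature.AnabelianGeometry.AbsoluteAnabelian
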